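import Summits.AtomisticToContinuum.FouriersLaw.Theses.VanishingNoiseTransfer
import Summits.AtomisticToContinuum.FouriersLaw.Theorems.VanishingNoiseTransferVanishingNoiseBoundOfSubharmonic

/-!
# Birth skeleton (BC3) — crux `VanishingNoiseTransfer.VanishingNoiseBound`
(item stmt-AtomisticToContinuum-11976, rank-3 crux of route `route-AtomisticToContinuum-VanishingNoiseTransfer`, sub-problem
`FouriersLaw`; skeleton registrar `planner-skel-stmt-AtomisticToContinuum-11976-0`, route re-audit bin REPAIRABLE, 2026-08-17).

PURPOSE. This file is the crux's BIRTH CERTIFICATE (LENSES-v3 BC3): a kernel-checked witness that the crux decomposes into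
≥ 2 named, non-trivial pieces neither of which is (cheaply, or in fact) the crux or the summit. It is NOT a new line of attack:
the five lines driven by leads c0–c4, a1, a2 are recorded dead in `Lines/*-dead.md`, and `PICKED.md` (a2) / `STRATEGY-CENSUS.md`
explain why no lead should be re-seated before the sibling crux stmt-11975 (`NoiseLocality`) produces an EXPLICIT modulus.

THE SPLIT (the Drude dichotomy in ONE-RATE WITNESS form; crux-ideate r1 card `Ideas/drude-or-bounded-dichotomy.md`, whose
conditional form was landed by lead c4 as p124007 `Theorems.VanishingNoiseBound.vanishingNoiseBound_of_linearNoiseLocality_of_subharmonic`).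
Under a LINEAR noise-locality modulus the only way `κ_ε(T)` can blow up as `ε ↓ 0` is at the harmonic/Mazur rate `κ_ε ≥ 1/(Cε)`
(Disproof §4 `cruxAt_false_of_inv_lower_bound`); one noisy conductivity below that rate excludes it. Hence two stubs:

* `stub_linearNoiseLocality` — MATTHIESSEN-LINEAR NOISE LOCALITY: for every `T > 0` a constant `C` with
  `|D⁰_N − D^ε_N| ≤ C·ε·|D⁰_N|·|D^ε_N|` for all `N`, all `ε ∈ (0,1]`, the unique deterministic and the unique flip-noisy steady
  families at length `N` and their responses at `T` (division-free `|1/D_N(ε) − 1/D_N(0)| ≤ Cε`: one flip scatterer per site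
  raises the chain's resistivity by `O(ε)`, uniformly in `N`). This is the sibling crux stmt-11975 with its modulus forced
  linear — the form its own plan (a) (Russo formula + sitewise locality, `w = C(T)ε`) targets; strictly STRONGER than 11975.
  Why it might fail: a `t^{-3/2}` current-autocorrelation tail would degrade the increment to `≍ √ε` (route text); N-uniformity
  at `ε = 0⁺` carries the 'limit exists' half of Fourier's law. It HOLDS in the harmonic corner (`r_N(0) → 0`, `r_N(ε) → cε`),
  where the crux fails — so it does not imply the crux. Size XL.
* `stub_subharmonicNoisyWitness` — ARBITRARILY DRUDE-SMALL NOISY WITNESSES: for every `T > 0` and every `c > 0` there is ONE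
  rate `ε ∈ (0,1]` at which the flip-noisy chain has a unique weak steady family at all `N, T_L, T_R > 0` whose responses at `T`
  converge, `D_N(ε) → κ > 0`, with `ε·κ ≤ c` (`liminf_{ε↓0} ε κ_ε(T) = 0` along rates where noisy Fourier holds: no flip-Drude
  weight). Implied by the sibling stmt-11977 (`NoisyFourier`) together with `ε κ_ε(T) → 0`; strictly WEAKER than
  `NoisyFourier ∧ VanishingNoiseBound` (bounded `κ_ε` is trivially sub-harmonic) and it does not imply the crux (it allows
  `κ_ε ≍ ε^{-1/2}`, the unpinned-corner numerics of Disproof §4 `UnpinnedCornerFails`). Why it might fail: every printed bound is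
  exactly harmonic-rate, `κ_ε ≤ Var(V′)/(4εT)` (Bernardin–Olla 2011 Prop 4); beating `1/ε` once needs an anharmonic corrector /
  flip-Drude completeness (no momentum-odd conserved charge of the infinite deterministic chain overlapping the current); and
  the boundary-driven noisy Fourier law at fixed `ε` is itself unproved for the anharmonic chain (BO2011 p. 3). Size XL.

COMPOSITION `VanishingNoiseBound_of : Stmt.stub_linearNoiseLocality → Stmt.stub_subharmonicNoisyWitness → VanishingNoiseBound` (the two stub
STATEMENTS by name — `Stmt.*` are the stubs' propositions verbatim, as `#h21_check_skeleton` requires — concluding the crux BY NAME;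
≈ 95 lines of real analysis, no `sorry` of its own; the literal form `<stub₁-sig> → <stub₂-sig> → VanishingNoiseBound` is the first
shape-check `example`): reference deterministic family by the landed `pinnedChain_exists_isSteadyState` + closed items
`NessUnique_holds` / `FiniteResponseOfUnique_holds` (responses `D⁰_N`); `C' = max C 1`; the witness at `c := 1/(2C')` gives a rate
`ε₀ ≤ 1` with `κ·C'ε₀ ≤ 1/2 < 1`, so by the landed one-noise-witness lemma `eventually_abs_le_of_oneNoiseWitness` (p124007)
`|D⁰_N| ≤ B := 2/(κ⁻¹ − C'ε₀)` eventually; then for every `ε ≤ ε₁ := min(1/((2B+2)C'), 1)`, every unique noisy family and every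
response sequence `D → k`, linear locality at rate `ε` against `D⁰` gives `D_N ≤ 2B + 2` eventually, hence `k ≤ K := 2B + 2`.
No exchange of limits; the `S`-binding is `subst`ed.

DISPROOF.LEAN (rev 4) USED. §3 `crux_false_without_SBinding`: both stubs carry the defining equation of `S` verbatim (the flip
predicate is never free). §3 `cruxAt_zero_false_of_exists_unique`: both stubs keep `0 < T`. §4 `cruxAt_false_of_inv_lower_bound` /
`cruxAt_false_harmonic`: stub 2 is precisely the negation of the killing shape `κ_ε ≥ c/ε along ε ↓ 0` (liminf form), and in the
harmonic corner stub 1 holds while stub 2 fails — the split puts the anharmonic content where the disprover says it lives.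
§1b + p122997 (`vanishingNoiseBound_iff_boundedResponse`) acknowledged (honest size): stub₁ ⇒ 11975, so stub₁ ∧ stub₂ ∧ 11977 ⊢
stmt-11071 (`BoundedResponse`) — the pair is crux-grade, as every sufficient stub set of this crux must be. Landed `Negative/`
lemmas checked: `WindowTwoChannel.windowTwoChannel_false` (p132995) and `InteriorDarkCarrier.staticInteriorCriterion_false`
(p135226) refute finite-`N` interior-window criteria on forward fields; neither stub is an instance (both quantify over NESS
response coefficients only).

BC3 PROBES (registrar folder `bc/probe_*.lean`, `bc/probe2_*.lean`; verbatim diagnostics in `Lines/birth.md`): for each stub,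
`stub → VanishingNoiseBound` and `stub → FouriersLaw` by `first | exact? | simpa | aesop` under `maxHeartbeats 400000` — all four
FAIL (rc 1); per tactic: `exact?` "could not close the goal" ×4 (no landed lemma of either shape), `simpa` heartbeat timeout ×4,
`aesop` "failed to prove the goal after exhaustive search" (stub₂, ×2) / heartbeat timeout (stub₁, ×2). `lean check --json` of
this file: rc 0, sorries = 2 = stubs (lines of `stub_linearNoiseLocality`, `stub_subharmonicNoisyWitness`), zero elsewhere;
`#print axioms VanishingNoiseBound_of` = propext, Classical.choice, Quot.sound.
-/

noncomputable section

open MeasureTheory Filter Topology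
open Literature.MathematicalPhysics.KineticTheory.HeatConduction

namespace Summit.AtomisticToContinuum.FouriersLaw.Cruxes.VanishingNoiseBound.Birth

/-- **Stub 1 · linearNoiseLocality** (sibling crux stmt-11975 `NoiseLocality` with the modulus forced LINEAR, `w(ε) = C ε`).
For `pinnedChain ω₂ lam β γ` (all `> 0`), the flip-steady predicate `S` bound by its defining equation, and `T > 0`: there is `C`
such that for every `N`, every `ε ∈ (0,1]`, the unique deterministic steady family `μ0` and the unique flip-noisy family `με` at
this `N`, and their response coefficients `D0`, `Dε` at `T`: `|D0 − Dε| ≤ C·ε·|D0|·|Dε|`.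
Why plausibly true: Matthiessen's rule — independent flip scatterers add `O(ε)` resistivity per unit length, uniformly in `N`
(Russo-type sitewise derivative formula with an `O(1/(N−1))` sitewise bound: the route's plan (a)). Why it might fail: see the
module docstring (`√ε` tails; N-uniform equicontinuity at `0⁺`). Size: XL (⊋ stmt-11975, open).
[cite: BernardinOlla2011, Thm 3 and Prop 4] [cite: BernardinHuveneersLebowitzLiveraniOlla2015, §1] -/
theorem stub_linearNoiseLocality :
    ∀ ω₂ lam β γ : ℝ, 0 < ω₂ → 0 < lam → 0 < β → 0 < γ → ∀ S : ℝ → (N : ℕ) → ℝ → ℝ → MeasureTheory.Measure (Literature.MathematicalPhysics.KineticTheory.HeatConduction.PhaseSpace N) → Prop, S = (fun (ε : ℝ) (N : ℕ) (T_L T_R : ℝ) (μ : MeasureTheory.Measure (Literature.MathematicalPhysics.KineticTheory.HeatConduction.PhaseSpace N)) => MeasureTheory.IsProbabilityMeasure μ ∧ (∀ f : Literature.MathematicalPhysics.KineticTheory.HeatConduction.PhaseSpace N → ℝ, ContDiff ℝ ((⊤ : ℕ∞) : WithTop ℕ∞) f → HasCompactSupport f → MeasureTheory.integral μ (fun x =>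 (Literature.MathematicalPhysics.KineticTheory.HeatConduction.pinnedChain ω₂ lam β γ).generator N T_L T_R f x + ε * ∑ i : Fin N, (f (x.1, Function.update x.2 i (-x.2 i)) - f x)) = 0) ∧ ∀ i : Fin N, MeasureTheory.Integrable ((Literature.MathematicalPhysics.KineticTheory.HeatConduction.pinnedChain ω₂ lam β γ).bondCurrent N i) μ) → ∀ T : ℝ, 0 < T → ∃ C : ℝ, ∀ (N : ℕ) (ε : ℝ), 0 < ε → ε ≤ 1 → ∀ μ0 με : ℝ → ℝ → MeasureTheory.Measure (Literature.MathematicalPhysics.KineticTheory.HeatConduction.PhaseSpace N), (∀ T_L T_R : ℝ, 0 < T_L → 0 < T_R → (Literature.MathematicalPhysics.KineticTheory.HeatConduction.pinnedChain ω₂ lam β γ).IsSteadyState N T_L T_R (μ0 T_L T_R) ∧ ∀ ν : MeasureTheory.Measure (Literature.MathematicalPhysics.KineticTheory.HeatConduction.PhaseSpace N), (Literature.MathematicalPhysics.KineticTheory.HeatConduction.pinnedChain ω₂ lam β γ).IsSteadyState N T_L T_R ν → ν = μ0 T_L T_R) → (∀ T_L T_R : ℝ, 0 < T_L → 0 < T_R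 → S ε N T_L T_R (με T_L T_R) ∧ ∀ ν : MeasureTheory.Measure (Literature.MathematicalPhysics.KineticTheory.HeatConduction.PhaseSpace N), S ε N T_L T_R ν → ν = με T_L T_R) → ∀ D0 Dε : ℝ, Filter.Tendsto (fun δ : ℝ => (Literature.MathematicalPhysics.KineticTheory.HeatConduction.pinnedChain ω₂ lam β γ).totalCurrent (μ0 (T + δ / 2) (T - δ / 2)) / δ) (nhdsWithin 0 {(0 : ℝ)}ᶜ) (nhds D0) → Filter.Tendsto (fun δ : ℝ => (Literature.MathematicalPhysics.KineticTheory.HeatConduction.pinnedChain ω₂ lam β γ).totalCurrent (με (T + δ / 2) (T - δ / 2)) / δ) (nhdsWithin 0 {(0 : ℝ)}ᶜ) (nhds Dε) → |D0 - Dε| ≤ C * ε * |D0| * |Dε| := by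
  sorry

/-- **Stub 2 · subharmonicNoisyWitness** (noisy Fourier at arbitrarily Drude-small rates). For `pinnedChain ω₂ lam β γ`
(all `> 0`), `S` bound by its defining equation, `T > 0` and every `c > 0`: there is a rate `ε ∈ (0,1]` and a family `μ` that is
the unique flip-steady state at rate `ε` for all `N, T_L, T_R > 0`, whose responses `D N` at `T` exist for all `N` and converge to
some `κ > 0` with `ε·κ ≤ c`.
Why plausibly true: for the anharmonic pinned chain `κ_ε(T)` should SATURATE at `κ(T) < ∞` (no conserved or ballistic structure
survives quartic pinning + coupling; the one printed data point for a pinned anharmonic chain with flips, Guimarães–Landi–de Oliveira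
2015, saturates), so `ε κ_ε → 0`; the statement asks only for `liminf ε κ_ε = 0`. Why it might fail: see the module docstring
(all printed bounds are `O(1/ε)`; noisy anharmonic Fourier at fixed `ε` unproved). Size: XL.
[cite: BernardinOlla2011, Prop 4] [cite: IacobucciEtAl2010, §1] -/
theorem stub_subharmonicNoisyWitness :
    ∀ ω₂ lam β γ : ℝ, 0 < ω₂ → 0 < lam → 0 < β → 0 < γ → ∀ S : ℝ → (N : ℕ) → ℝ → ℝ → MeasureTheory.Measure (Literature.MathematicalPhysics.KineticTheory.HeatConduction.PhaseSpace N) → Prop, S = (fun (ε : ℝ) (N : ℕ) (T_L T_R : ℝ) (μ : MeasureTheory.Measure (Literature.MathematicalPhysics.KineticTheory.HeatConduction.PhaseSpace N)) => MeasureTheory.IsProbabilityMeasure μ ∧ (∀ f : Literature.MathematicalPhysics.KineticTheory.HeatConduction.PhaseSpace N → ℝ, ContDiff ℝ ((⊤ : ℕ∞) : WithTop ℕ∞) f → HasCompactSupport f → MeasureTheory.integral μ (fun x => (Literature.MathematicalPhysics.KineticTheory.HeatConduction.pinnedChain ω₂ lam β γ).generator N T_L T_R f x + ε * ∑ i : Fin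 N, (f (x.1, Function.update x.2 i (-x.2 i)) - f x)) = 0) ∧ ∀ i : Fin N, MeasureTheory.Integrable ((Literature.MathematicalPhysics.KineticTheory.HeatConduction.pinnedChain ω₂ lam β γ).bondCurrent N i) μ) → ∀ T : ℝ, 0 < T → ∀ c : ℝ, 0 < c → ∃ ε : ℝ, 0 < ε ∧ ε ≤ 1 ∧ ∃ μ : (N : ℕ) → ℝ → ℝ → MeasureTheory.Measure (Literature.MathematicalPhysics.KineticTheory.HeatConduction.PhaseSpace N), (∀ (N : ℕ) (T_L T_R : ℝ), 0 < T_L → 0 < T_R → S ε N T_L T_R (μ N T_L T_R) ∧ ∀ ν : MeasureTheory.Measure (Literature.MathematicalPhysics.KineticTheory.HeatConduction.PhaseSpace N), S ε N T_L T_R ν → ν = μ N T_L T_R) ∧ ∃ (D : ℕ → ℝ) (κ : ℝ), (∀ N : ℕ, Filter.Tendsto (fun δ : ℝ => (Literature.MathematicalPhysics.KineticTheory.HeatConduction.pinnedChain ω₂ lam β γ).totalCurrent (μ N (T + δ / 2) (T - δ / 2)) / δ) (nhdsWithin 0 {(0 : ℝ)}ᶜ) (nhds (D N))) ∧ Filter.Tendsto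 D Filter.atTop (nhds κ) ∧ 0 < κ ∧ ε * κ ≤ c := by
  sorry

/-! ## The stub statements as NAMED propositions
(`#h21_check_skeleton` admits as hypotheses of the skeleton theorem only registered obligations / declared stubs BY NAME; these two
definitions are the statements of `stub_linearNoiseLocality` / `stub_subharmonicNoisyWitness` verbatim, so that
`VanishingNoiseBound_of` takes exactly the two stubs, by name, and nothing else.) -/

/-- Statement of the registered stub `stub_linearNoiseLocality`, by name (verbatim the same proposition). -/
def Stmt.stub_linearNoiseLocality : Prop :=
  ∀ ω₂ lam β γ : ℝ, 0 < ω₂ → 0 < lam → 0 < β → 0 < γ → ∀ S : ℝ → (N : ℕ) → ℝ → ℝ → MeasureTheory.Measure (Literature.MathematicalPhysics.KineticTheory.HeatConduction.PhaseSpace N) → Prop, S = (fun (ε : ℝ) (N : ℕ) (T_L T_R : ℝ) (μ : MeasureTheory.Measure (Literature.MathematicalPhysics.KineticTheory.HeatConduction.PhaseSpace N)) => MeasureTheory.IsProbabilityMeasure μ ∧ (∀ f : Literature.MathematicalPhysics.KineticTheory.HeatConduction.PhaseSpace N → ℝ, ContDiff ℝ ((⊤ : ℕ∞) : WithTop ℕ∞)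 f → HasCompactSupport f → MeasureTheory.integral μ (fun x => (Literature.MathematicalPhysics.KineticTheory.HeatConduction.pinnedChain ω₂ lam β γ).generator N T_L T_R f x + ε * ∑ i : Fin N, (f (x.1, Function.update x.2 i (-x.2 i)) - f x)) = 0) ∧ ∀ i : Fin N, MeasureTheory.Integrable ((Literature.MathematicalPhysics.KineticTheory.HeatConduction.pinnedChain ω₂ lam β γ).bondCurrent N i) μ) → ∀ T : ℝ, 0 < T → ∃ C : ℝ, ∀ (N : ℕ) (ε : ℝ), 0 < ε → ε ≤ 1 → ∀ μ0 με : ℝ → ℝ → MeasureTheory.Measure (Literature.MathematicalPhysics.KineticTheory.HeatConduction.PhaseSpace N), (∀ T_L T_R : ℝ, 0 < T_L → 0 < T_R → (Literature.MathematicalPhysics.KineticTheory.HeatConduction.pinnedChain ω₂ lam β γ).IsSteadyState N T_L T_R (μ0 T_L T_R) ∧ ∀ ν : MeasureTheory.Measure (Literature.MathematicalPhysics.KineticTheory.HeatConduction.PhaseSpace N), (Literature.MathematicalPhysics.KineticTheory.HeatConduction.pinnedChain ω₂ lam β γ).IsSteadyState N T_L T_R ν → ν = μ0 T_L T_R) →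 (∀ T_L T_R : ℝ, 0 < T_L → 0 < T_R → S ε N T_L T_R (με T_L T_R) ∧ ∀ ν : MeasureTheory.Measure (Literature.MathematicalPhysics.KineticTheory.HeatConduction.PhaseSpace N), S ε N T_L T_R ν → ν = με T_L T_R) → ∀ D0 Dε : ℝ, Filter.Tendsto (fun δ : ℝ => (Literature.MathematicalPhysics.KineticTheory.HeatConduction.pinnedChain ω₂ lam β γ).totalCurrent (μ0 (T + δ / 2) (T - δ / 2)) / δ) (nhdsWithin 0 {(0 : ℝ)}ᶜ) (nhds D0) → Filter.Tendsto (fun δ : ℝ => (Literature.MathematicalPhysics.KineticTheory.HeatConduction.pinnedChain ω₂ lam β γ).totalCurrent (με (T + δ / 2) (T - δ / 2)) / δ) (nhdsWithin 0 {(0 : ℝ)}ᶜ) (nhds Dε) → |D0 - Dε| ≤ C * ε * |D0| * |Dε|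

/-- Statement of the registered stub `stub_subharmonicNoisyWitness`, by name (verbatim the same proposition). -/
def Stmt.stub_subharmonicNoisyWitness : Prop :=
  ∀ ω₂ lam β γ : ℝ, 0 < ω₂ → 0 < lam → 0 < β → 0 < γ → ∀ S : ℝ → (N : ℕ) → ℝ → ℝ → MeasureTheory.Measure (Literature.MathematicalPhysics.KineticTheory.HeatConduction.PhaseSpace N) → Prop, S = (fun (ε : ℝ) (N : ℕ) (T_L T_R : ℝ) (μ : MeasureTheory.Measure (Literature.MathematicalPhysics.KineticTheory.HeatConduction.PhaseSpace N)) => MeasureTheory.IsProbabilityMeasure μ ∧ (∀ f : Literature.MathematicalPhysics.KineticTheory.HeatConduction.PhaseSpace N → ℝ, ContDiff ℝ ((⊤ : ℕ∞) : WithTop ℕ∞) f → HasCompactSupport f → MeasureTheory.integral μ (fun x => (Literature.MathematicalPhysics.KineticTheory.HeatConduction.pinnedChain ω₂ lam β γ).generator N T_L T_R f x + ε * ∑ i : Fin N, (f (x.1, Function.update x.2 i (-x.2 i)) - f x)) = 0) ∧ ∀ i : Fin N, MeasureTheory.Integrable ((Literature.MathematicalPhysics.KineticTheory.HeatConduction.pinnedChain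 ω₂ lam β γ).bondCurrent N i) μ) → ∀ T : ℝ, 0 < T → ∀ c : ℝ, 0 < c → ∃ ε : ℝ, 0 < ε ∧ ε ≤ 1 ∧ ∃ μ : (N : ℕ) → ℝ → ℝ → MeasureTheory.Measure (Literature.MathematicalPhysics.KineticTheory.HeatConduction.PhaseSpace N), (∀ (N : ℕ) (T_L T_R : ℝ), 0 < T_L → 0 < T_R → S ε N T_L T_R (μ N T_L T_R) ∧ ∀ ν : MeasureTheory.Measure (Literature.MathematicalPhysics.KineticTheory.HeatConduction.PhaseSpace N), S ε N T_L T_R ν → ν = μ N T_L T_R) ∧ ∃ (D : ℕ → ℝ) (κ : ℝ), (∀ N : ℕ, Filter.Tendsto (fun δ : ℝ => (Literature.MathematicalPhysics.KineticTheory.HeatConduction.pinnedChain ω₂ lam β γ).totalCurrent (μ N (T + δ / 2) (T - δ / 2)) / δ) (nhdsWithin 0 {(0 : ℝ)}ᶜ) (nhds (D N))) ∧ Filter.Tendsto D Filter.atTop (nhds κ) ∧ 0 < κ ∧ ε * κ ≤ c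

/-- **THE SKELETON THEOREM** (kernel-checked, no `sorry` of its own; the only theorem of this file concluding the crux):
the two stubs — by name (`Stmt.stub_linearNoiseLocality`, `Stmt.stub_subharmonicNoisyWitness`, definitionally their signatures) —
imply `Theses.VanishingNoiseTransfer.VanishingNoiseBound` BY NAME. Proof = the Drude dichotomy in one-rate form (module docstring,
COMPOSITION). -/
theorem VanishingNoiseBound_of (hLNL : Stmt.stub_linearNoiseLocality) (hW : Stmt.stub_subharmonicNoisyWitness) :
    Theses.VanishingNoiseTransfer.VanishingNoiseBound := by
  -- the by-name stub statements, unfolded to their signatures (definitional)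
  have hLNL' : ∀ ω₂ lam β γ : ℝ, 0 < ω₂ → 0 < lam → 0 < β → 0 < γ → ∀ S : ℝ → (N : ℕ) → ℝ → ℝ → MeasureTheory.Measure (Literature.MathematicalPhysics.KineticTheory.HeatConduction.PhaseSpace N) → Prop, S = (fun (ε : ℝ) (N : ℕ) (T_L T_R : ℝ) (μ : MeasureTheory.Measure (Literature.MathematicalPhysics.KineticTheory.HeatConduction.PhaseSpace N)) => MeasureTheory.IsProbabilityMeasure μ ∧ (∀ f : Literature.MathematicalPhysics.KineticTheory.HeatConduction.PhaseSpace N → ℝ, ContDiff ℝ ((⊤ : ℕ∞) : WithTop ℕ∞) f → HasCompactSupport f → MeasureTheory.integral μ (fun x => (Literature.MathematicalPhysics.KineticTheory.HeatConduction.pinnedChain ω₂ lam β γ).generator N T_L T_R f x + ε * ∑ i : Fin N, (f (x.1, Function.update x.2 i (-x.2 i)) - f x)) = 0) ∧ ∀ i : Fin N, MeasureTheory.Integrable ((Literature.MathematicalPhysics.KineticTheory.HeatConduction.pinnedChain ω₂ lam β γ).bondCurrent N i) μ) → ∀ T : ℝ, 0 < T → ∃ C : ℝ, ∀ (N : ℕ)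 (ε : ℝ), 0 < ε → ε ≤ 1 → ∀ μ0 με : ℝ → ℝ → MeasureTheory.Measure (Literature.MathematicalPhysics.KineticTheory.HeatConduction.PhaseSpace N), (∀ T_L T_R : ℝ, 0 < T_L → 0 < T_R → (Literature.MathematicalPhysics.KineticTheory.HeatConduction.pinnedChain ω₂ lam β γ).IsSteadyState N T_L T_R (μ0 T_L T_R) ∧ ∀ ν : MeasureTheory.Measure (Literature.MathematicalPhysics.KineticTheory.HeatConduction.PhaseSpace N), (Literature.MathematicalPhysics.KineticTheory.HeatConduction.pinnedChain ω₂ lam β γ).IsSteadyState N T_L T_R ν → ν = μ0 T_L T_R) → (∀ T_L T_R : ℝ, 0 < T_L → 0 < T_R → S ε N T_L T_R (με T_L T_R) ∧ ∀ ν : MeasureTheory.Measure (Literature.MathematicalPhysics.KineticTheory.HeatConduction.PhaseSpace N), S ε N T_L T_R ν → ν = με T_L T_R) → ∀ D0 Dε : ℝ, Filter.Tendsto (fun δ : ℝ => (Literature.MathematicalPhysics.KineticTheory.HeatConduction.pinnedChain ω₂ lam β γ).totalCurrent (μ0 (T + δ / 2) (T - δ / 2)) / δ) (nhdsWithin 0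 {(0 : ℝ)}ᶜ) (nhds D0) → Filter.Tendsto (fun δ : ℝ => (Literature.MathematicalPhysics.KineticTheory.HeatConduction.pinnedChain ω₂ lam β γ).totalCurrent (με (T + δ / 2) (T - δ / 2)) / δ) (nhdsWithin 0 {(0 : ℝ)}ᶜ) (nhds Dε) → |D0 - Dε| ≤ C * ε * |D0| * |Dε| := hLNL
  have hW' : ∀ ω₂ lam β γ : ℝ, 0 < ω₂ → 0 < lam → 0 < β → 0 < γ → ∀ S : ℝ → (N : ℕ) → ℝ → ℝ → MeasureTheory.Measure (Literature.MathematicalPhysics.KineticTheory.HeatConduction.PhaseSpace N) → Prop, S = (fun (ε : ℝ) (N : ℕ) (T_L T_R : ℝ) (μ : MeasureTheory.Measure (Literature.MathematicalPhysics.KineticTheory.HeatConduction.PhaseSpace N)) => MeasureTheory.IsProbabilityMeasure μ ∧ (∀ f : Literature.MathematicalPhysics.KineticTheory.HeatConduction.PhaseSpace N → ℝ, ContDiff ℝ ((⊤ : ℕ∞) : WithTop ℕ∞) f → HasCompactSupport f → MeasureTheory.integral μ (fun x => (Literature.MathematicalPhysics.KineticTheory.HeatConduction.pinnedChain ω₂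 lam β γ).generator N T_L T_R f x + ε * ∑ i : Fin N, (f (x.1, Function.update x.2 i (-x.2 i)) - f x)) = 0) ∧ ∀ i : Fin N, MeasureTheory.Integrable ((Literature.MathematicalPhysics.KineticTheory.HeatConduction.pinnedChain ω₂ lam β γ).bondCurrent N i) μ) → ∀ T : ℝ, 0 < T → ∀ c : ℝ, 0 < c → ∃ ε : ℝ, 0 < ε ∧ ε ≤ 1 ∧ ∃ μ : (N : ℕ) → ℝ → ℝ → MeasureTheory.Measure (Literature.MathematicalPhysics.KineticTheory.HeatConduction.PhaseSpace N), (∀ (N : ℕ) (T_L T_R : ℝ), 0 < T_L → 0 < T_R → S ε N T_L T_R (μ N T_L T_R) ∧ ∀ ν : MeasureTheory.Measure (Literature.MathematicalPhysics.KineticTheory.HeatConduction.PhaseSpace N), S ε N T_L T_R ν → ν = μ N T_L T_R) ∧ ∃ (D : ℕ → ℝ) (κ : ℝ), (∀ N : ℕ, Filter.Tendsto (fun δ : ℝ => (Literature.MathematicalPhysics.KineticTheory.HeatConduction.pinnedChain ω₂ lam β γ).totalCurrent (μ N (T + δ / 2) (T - δ / 2)) / δ) (nhdsWithin 0 {(0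 : ℝ)}ᶜ) (nhds (D N))) ∧ Filter.Tendsto D Filter.atTop (nhds κ) ∧ 0 < κ ∧ ε * κ ≤ c := hW
  clear hLNL hW
  intro ω₂ lam β γ hω hl hβ hγ S hS T hT
  have huniq := Theses.VanishingNoiseTransfer.NessUnique_holds ω₂ lam β γ hω hl hβ hγ
  -- (0) the unique deterministic steady family (landed existence theorem + closed item NessUnique), by choice, and its responses
  have hex : ∀ (N : ℕ) (T_L T_R : ℝ), 0 < T_L → 0 < T_R →
      ∃ μ : Measure (PhaseSpace N), (pinnedChain ω₂ lam β γ).IsSteadyState N T_L T_R μ :=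
    fun N T_L T_R hL hR' => pinnedChain_exists_isSteadyState hω hl hβ hγ N hL hR'
  classical
  let μ0 : (N : ℕ) → ℝ → ℝ → Measure (PhaseSpace N) := fun N T_L T_R =>
    if h : 0 < T_L ∧ 0 < T_R then Classical.choose (hex N T_L T_R h.1 h.2) else 0
  have hμ0 : ∀ (N : ℕ) (T_L T_R : ℝ), 0 < T_L → 0 < T_R →
      (pinnedChain ω₂ lam β γ).IsSteadyState N T_L T_R (μ0 N T_L T_R) := by
    intro N T_L T_R hL hR'
    simp only [μ0, dif_pos (And.intro hL hR')]
    exact Classical.choose_spec (hex N T_L T_R hL hR')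
  -- finite-`N` responses of the reference family (closed item FiniteResponseOfUnique)
  have hD0ex := Theses.VanishingNoiseTransfer.FiniteResponseOfUnique_holds ω₂ lam β γ hω hl hβ hγ huniq μ0 hμ0 T hT
  choose D0 hD0 using hD0ex
  -- (1) the linear modulus constant `C`, enlarged to `C' = max C 1 > 0`
  obtain ⟨C, hC⟩ := hLNL' ω₂ lam β γ hω hl hβ hγ S hS T hT
  set C' : ℝ := max C 1 with hC'def
  have hC'pos : 0 < C' := lt_of_lt_of_le one_pos (le_max_right _ _)
  have hCC' : C ≤ C' := le_max_left _ _
  -- locality with `C'` in place of `C`, the deterministic family fixed to the reference one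
  have hC' : ∀ (N : ℕ) (ε : ℝ), 0 < ε → ε ≤ 1 → ∀ με : ℝ → ℝ → Measure (PhaseSpace N),
      (∀ T_L T_R : ℝ, 0 < T_L → 0 < T_R → S ε N T_L T_R (με T_L T_R) ∧
        ∀ ν : Measure (PhaseSpace N), S ε N T_L T_R ν → ν = με T_L T_R) →
      ∀ Dε : ℝ, Tendsto (fun δ : ℝ =>
          (pinnedChain ω₂ lam β γ).totalCurrent (με (T + δ / 2) (T - δ / 2)) / δ) (𝓝[≠] 0) (𝓝 Dε) →
        |D0 N - Dε| ≤ C' * ε * |D0 N| * |Dε| := by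
    intro N ε hε hε1 με hμε Dε hDε
    have h := hC N ε hε hε1 (μ0 N) με
      (fun T_L T_R hL hR' => ⟨hμ0 N T_L T_R hL hR',
        fun ν hν => huniq N T_L T_R hL hR' ν _ hν (hμ0 N T_L T_R hL hR')⟩)
      hμε (D0 N) Dε (hD0 N) hDε
    have hmono : C * ε * |D0 N| * |Dε| ≤ C' * ε * |D0 N| * |Dε| := by
      have h0 : 0 ≤ ε * |D0 N| * |Dε| := by positivity
      nlinarith
    exact h.trans hmono
  -- (2) the sub-harmonic witness with `c := 1/(2C')`: a rate `ε₀ ∈ (0,1]`, its unique noisy family `με`,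
  --     responses `Dε N → κ > 0`, and `ε₀ κ ≤ 1/(2C')`
  obtain ⟨ε₀, hε₀, hε₀1, με, hμε, Dε, κ, hDε, hDεlim, hκ₀, hεκ⟩ :=
    hW' ω₂ lam β γ hω hl hβ hγ S hS T hT (1 / (2 * C')) (by positivity)
  -- (3) the one-noise witness at `ε₀`: `κ · (C' ε₀) ≤ 1/2 < 1`, hence `|D0 N| ≤ B` eventually
  have hlocN : ∀ N : ℕ, |D0 N - Dε N| ≤ C' * ε₀ * |D0 N| * |Dε N| := fun N =>
    hC' N ε₀ hε₀ hε₀1 (με N) (fun T_L T_R hL hR' => hμε N T_L T_R hL hR') (Dε N) (hDε N)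
  have hw : κ * (C' * ε₀) < 1 := by
    have h1 : κ * (C' * ε₀) = C' * (ε₀ * κ) := by ring
    have h2 : C' * (ε₀ * κ) ≤ C' * (1 / (2 * C')) := mul_le_mul_of_nonneg_left hεκ hC'pos.le
    have h3 : C' * (1 / (2 * C')) = 1 / 2 := by field_simp
    linarith
  have hevB := Theorems.VanishingNoiseBound.eventually_abs_le_of_oneNoiseWitness hκ₀ hw hlocN hDεlim
  set B : ℝ := 2 / (κ⁻¹ - C' * ε₀) with hBdef
  have hgap : 0 < κ⁻¹ - C' * ε₀ := by
    have : C' * ε₀ < κ⁻¹ := by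
      rw [← one_div, lt_div_iff₀ hκ₀]
      linarith [mul_comm κ (C' * ε₀)]
    linarith
  have hBpos : 0 < B := by positivity
  have hA : (0 : ℝ) < 2 * B + 2 := by positivity
  -- (4) the crux: `K := 2B + 2`, `ε₁ := min (1/((2B+2) C')) 1`
  subst hS
  refine ⟨2 * B + 2, min (1 / ((2 * B + 2) * C')) 1, lt_min (by positivity) one_pos, ?_⟩
  intro ε hε hεle μ hμ D k hD hk
  have hε1 : ε ≤ 1 := hεle.trans (min_le_right _ _)
  have hCε : C' * ε ≤ 1 / (2 * B + 2) := by
    have h1 : ε ≤ 1 / ((2 * B + 2) * C') := hεle.trans (min_le_left _ _)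
    calc C' * ε ≤ C' * (1 / ((2 * B + 2) * C')) := mul_le_mul_of_nonneg_left h1 hC'pos.le
      _ = 1 / (2 * B + 2) := by field_simp
  -- linear locality at rate `ε`, at each length `N`, against the reference deterministic responses
  have hN : ∀ N : ℕ, |D0 N - D N| ≤ C' * ε * |D0 N| * |D N| := fun N =>
    hC' N ε hε hε1 (μ N) (fun T_L T_R hL hR' => hμ N T_L T_R hL hR') (D N) (hD N)
  -- hence `D_N(ε) ≤ 2B + 2` eventually in `N`
  have hev : ∀ᶠ N in atTop, D N ≤ 2 * B + 2 := by
    filter_upwards [hevB] with N hBN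
    by_cases hDN : D N ≤ 0
    · linarith
    · have hDN : 0 < D N := not_le.mp hDN
      have h1 := hN N
      have h2 : D N - D0 N ≤ C' * ε * |D0 N| * |D N| := by
        have h3 : D N - D0 N ≤ |D0 N - D N| := by
          rw [abs_sub_comm]
          exact le_abs_self _
        exact h3.trans h1
      rw [abs_of_pos hDN] at h2
      have h4 : C' * ε * |D0 N| * D N ≤ 1 / (2 * B + 2) * B * D N := by
        have h5 : C' * ε * |D0 N| ≤ 1 / (2 * B + 2) * B :=
          mul_le_mul hCε hBN (abs_nonneg _) (by positivity)
        exact mul_le_mul_of_nonneg_right h5 hDN.le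
      have h6 : 1 / (2 * B + 2) * B ≤ 1 / 2 := by
        rw [div_mul_eq_mul_div, one_mul, div_le_iff₀ hA]
        linarith
      have h7 : 1 / (2 * B + 2) * B * D N ≤ 1 / 2 * D N := mul_le_mul_of_nonneg_right h6 hDN.le
      have h8 : D0 N ≤ B := (le_abs_self _).trans hBN
      linarith
  exact le_of_tendsto hk hev

/-- Shape check 1 (an `example`, so that `VanishingNoiseBound_of` stays the unique theorem concluding the crux): the literal BC3
form `<stub₁-sig> → <stub₂-sig> → VanishingNoiseBound`, signatures inline — definitionally the type of `VanishingNoiseBound_of`. -/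
example :
    (∀ ω₂ lam β γ : ℝ, 0 < ω₂ → 0 < lam → 0 < β → 0 < γ → ∀ S : ℝ → (N : ℕ) → ℝ → ℝ → MeasureTheory.Measure (Literature.MathematicalPhysics.KineticTheory.HeatConduction.PhaseSpace N) → Prop, S = (fun (ε : ℝ) (N : ℕ) (T_L T_R : ℝ) (μ : MeasureTheory.Measure (Literature.MathematicalPhysics.KineticTheory.HeatConduction.PhaseSpace N)) => MeasureTheory.IsProbabilityMeasure μ ∧ (∀ f : Literature.MathematicalPhysics.KineticTheory.HeatConduction.PhaseSpace N → ℝ, ContDiff ℝ ((⊤ : ℕ∞) : WithTop ℕ∞) f → HasCompactSupport f → MeasureTheory.integral μ (fun x => (Literature.MathematicalPhysics.KineticTheory.HeatConduction.pinnedChain ω₂ lam β γ).generator N T_L T_R f x + ε * ∑ i : Fin N, (f (x.1, Function.update x.2 i (-x.2 i)) - f x)) = 0) ∧ ∀ i : Fin N, MeasureTheory.Integrable ((Literature.MathematicalPhysics.KineticTheory.HeatConduction.pinnedChain ω₂ lam β γ).bondCurrent N i) μ) → ∀ T : ℝ, 0 < T → ∃ C : ℝ, ∀ (N : ℕ) (ε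 : ℝ), 0 < ε → ε ≤ 1 → ∀ μ0 με : ℝ → ℝ → MeasureTheory.Measure (Literature.MathematicalPhysics.KineticTheory.HeatConduction.PhaseSpace N), (∀ T_L T_R : ℝ, 0 < T_L → 0 < T_R → (Literature.MathematicalPhysics.KineticTheory.HeatConduction.pinnedChain ω₂ lam β γ).IsSteadyState N T_L T_R (μ0 T_L T_R) ∧ ∀ ν : MeasureTheory.Measure (Literature.MathematicalPhysics.KineticTheory.HeatConduction.PhaseSpace N), (Literature.MathematicalPhysics.KineticTheory.HeatConduction.pinnedChain ω₂ lam β γ).IsSteadyState N T_L T_R ν → ν = μ0 T_L T_R) → (∀ T_L T_R : ℝ, 0 < T_L → 0 < T_R → S ε N T_L T_R (με T_L T_R) ∧ ∀ ν : MeasureTheory.Measure (Literature.MathematicalPhysics.KineticTheory.HeatConduction.PhaseSpace N), S ε N T_L T_R ν → ν = με T_L T_R) → ∀ D0 Dε : ℝ, Filter.Tendsto (fun δ : ℝ => (Literature.MathematicalPhysics.KineticTheory.HeatConduction.pinnedChain ω₂ lam β γ).totalCurrent (μ0 (T + δ / 2) (T - δ / 2)) / δ) (nhdsWithin 0 {(0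 : ℝ)}ᶜ) (nhds D0) → Filter.Tendsto (fun δ : ℝ => (Literature.MathematicalPhysics.KineticTheory.HeatConduction.pinnedChain ω₂ lam β γ).totalCurrent (με (T + δ / 2) (T - δ / 2)) / δ) (nhdsWithin 0 {(0 : ℝ)}ᶜ) (nhds Dε) → |D0 - Dε| ≤ C * ε * |D0| * |Dε|) →
    (∀ ω₂ lam β γ : ℝ, 0 < ω₂ → 0 < lam → 0 < β → 0 < γ → ∀ S : ℝ → (N : ℕ) → ℝ → ℝ → MeasureTheory.Measure (Literature.MathematicalPhysics.KineticTheory.HeatConduction.PhaseSpace N) → Prop, S = (fun (ε : ℝ) (N : ℕ) (T_L T_R : ℝ) (μ : MeasureTheory.Measure (Literature.MathematicalPhysics.KineticTheory.HeatConduction.PhaseSpace N)) => MeasureTheory.IsProbabilityMeasure μ ∧ (∀ f : Literature.MathematicalPhysics.KineticTheory.HeatConduction.PhaseSpace N → ℝ, ContDiff ℝ ((⊤ : ℕ∞) : WithTop ℕ∞) f → HasCompactSupport f → MeasureTheory.integral μ (fun x => (Literature.MathematicalPhysics.KineticTheory.HeatConduction.pinnedChain ω₂ lam β γ).generator N T_L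 T_R f x + ε * ∑ i : Fin N, (f (x.1, Function.update x.2 i (-x.2 i)) - f x)) = 0) ∧ ∀ i : Fin N, MeasureTheory.Integrable ((Literature.MathematicalPhysics.KineticTheory.HeatConduction.pinnedChain ω₂ lam β γ).bondCurrent N i) μ) → ∀ T : ℝ, 0 < T → ∀ c : ℝ, 0 < c → ∃ ε : ℝ, 0 < ε ∧ ε ≤ 1 ∧ ∃ μ : (N : ℕ) → ℝ → ℝ → MeasureTheory.Measure (Literature.MathematicalPhysics.KineticTheory.HeatConduction.PhaseSpace N), (∀ (N : ℕ) (T_L T_R : ℝ), 0 < T_L → 0 < T_R → S ε N T_L T_R (μ N T_L T_R) ∧ ∀ ν : MeasureTheory.Measure (Literature.MathematicalPhysics.KineticTheory.HeatConduction.PhaseSpace N), S ε N T_L T_R ν → ν = μ N T_L T_R) ∧ ∃ (D : ℕ → ℝ) (κ : ℝ), (∀ N : ℕ, Filter.Tendsto (fun δ : ℝ => (Literature.MathematicalPhysics.KineticTheory.HeatConduction.pinnedChain ω₂ lam β γ).totalCurrent (μ N (T + δ / 2) (T - δ / 2)) / δ) (nhdsWithin 0 {(0 : ℝ)}ᶜ)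 (nhds (D N))) ∧ Filter.Tendsto D Filter.atTop (nhds κ) ∧ 0 < κ ∧ ε * κ ≤ c) →
    Theses.VanishingNoiseTransfer.VanishingNoiseBound :=
  fun h₁ h₂ => VanishingNoiseBound_of h₁ h₂

/-- Shape check 2: the sorried stubs feed the composition definitionally; once both `sorry`s are discharged this term IS a proof
of the crux. -/
example : Theses.VanishingNoiseTransfer.VanishingNoiseBound :=
  VanishingNoiseBound_of stub_linearNoiseLocality stub_subharmonicNoisyWitness

end Summit.AtomisticToContinuum.FouriersLaw.Cruxes.VanishingNoiseBound.Birth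

end
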